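import Summits.HodgeConjecture.HodgeConjecture.Theorems.H413CohFormsCarriersLemmas
import Literature.AlgebraicGeometry.ShimuraVarieties.UnitaryBallCotangentWeight
import HarnessLib

/-!
# FLOOR-0 P3 ∕ P4 carriers — the two Hodge types of degree one are DISJOINT and separately `U(V)(𝔸_{F⁺,f})`-stable
# (`cohForms 𝔞 = holCotForms 𝔞 ⊕ conj (holCotForms 𝔞)` as `G_f`-modules)

Cell hodgecm-mathlib (D-0151), FLOOR 0, crux item H413 = stmt-HodgeConjecture-24833.  PROOF lane (theorems only, no definition,
no named fact), `--supports stmt-HodgeConjecture-24833`.  Author A-p09 (g18).  Serves the stub «S2 `stub_hodgeTypes_disjoint_stable`: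
`Disjoint A B` and `A`, `B` are `rightRep`-stable, `A := holCotForms 𝔞₀`, `B := A.map conjFun`» of programme P3's line-to-be
`Cruxes/H413/Lines/F0-U3CohMultOne.lean` (F0P3-plan (g0), `F0/P3/P3-SCOPE-AUDIT-part2.F0P3g0.md` §5), and P4-T2′'s clause
«`holCotForms ∩ conj (holCotForms) = 0`» (A-p13 (g21) T2-PLAN-MEMO G3).

For an archimedean factor `𝔞 = (ιinf, K_c)` of the carriers file ★ `Theorems/H413CohFormsCarriers` (`holCotForms 𝔞` = left
`U(V)(F⁺)`-invariant, right `K_c`-invariant, smooth, holomorphic-germed `ℂ²`-valued functions on `U(V)(𝔸_{F⁺})` of right `K_∞`-type the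
cotangent weight `τ₁ = weightOf x₀` along `ιinf ∘ Stab(x₀)`; `conjFun` = componentwise complex conjugation):

* §1 **`disjoint_holCotForms_map_conjFun`** — `holCotForms 𝔞 ⊓ conj (holCotForms 𝔞) = 0` for EVERY `𝔞` (no honesty needed): a form
  `f` of type `τ₁` which is the conjugate of a form `g` of type `τ₁` transforms under the central circle element
  `k_I = ιinf (diag(1, 1, ·) ↔ (1, i) ∈ U(2) × U(1))` of `Stab(x₀)` by `τ₁(k_I) = i` (★ `BallForms.weightOf_cotangent_blockK`: `τ₁ = 𝔭₋`,
  `(A, d) ↦ d • Ā`) AND by `conj (τ₁(k_I)) = −i`, so `2i • f = 0`.  This is the weight-`(1,0)` versus weight-`(0,1)` disjointness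
  of [BorelWallach2000, VII 2.10] (the bigrading `C^{p,q}` of the relative complex by `𝔭^±`-types) read on the cotangent `K_∞`-type.
* §2 **`IsHonest.rightRep_mem_map_conjFun_holCotForms`** — `conj (holCotForms 𝔞)` is stable under the finite-adelic right translation
  `R_g` for an HONEST `𝔞` (★ `IsHonest.rightRep_mem_holCotForms` + ★ `conjFun_rightRep`, A-p13 (g21)); submodule forms
  `holCotForms_le_comap_rightRep`, `map_conjFun_holCotForms_le_comap_rightRep`.
* §3 **`IsHonest.hodgeTypes_disjoint_stable`** — the conjunction in the shape of the stub (per face, at any honest `𝔞`; the factor of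
  record `archFactorOf F V` is honest by ★ `P4StubT1ArchFactor.archFactorOf_isHonest`).

HC_CM is proved only modulo the 7 printed citations until rung 0 closes; this file proves nothing about them.

## References
* [BorelWallach2000] A. Borel, N. Wallach, *Continuous cohomology, discrete subgroups, and representations of reductive groups*, 2nd ed.,
  AMS 2000 — VI 4.8 (the `K`-types `τ₁`, `τ₁^*` of `𝔭^±` for `SU(n,1)`), VII 2.10 (the bigrading of `(𝔤,K)`-cochains ∕ forms by Hodge type).
* [BorelJacquet1979] A. Borel, H. Jacquet, *Automorphic forms and automorphic representations*, PSPM 33.1 — §4.2 (right translation,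
  smoothness).
* Tree: ★ `Theorems/H413CohFormsCarriers` (A-p13 (g21), p787557), ★ `Theorems/H413CohFormsCarriersLemmas` (p788968),
  ★ `ShimuraVarieties/UnitaryBallCotangentWeight` (`weightOf_cotangent_blockK`), ★ `Automorphic/U21KTypes` (`pMinus_apply`),
  ★ `ComplexHyperbolic/UnitBallIsotropyBlock` (`blockK`).
-/

set_option autoImplicit false
set_option linter.dupNamespace false

noncomputable section

namespace Summit.HodgeConjecture.HodgeConjecture.Cruxes.H413.CohFormsCarriers

open NumberField MulAction
open Literature.NumberTheory.Automorphic
open Literature.NumberTheory.Automorphic.U21 (K21 matA sclD pMinus pMinus_apply)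
open Literature.AlgebraicGeometry.ShimuraVarieties
open Literature.Geometry.ComplexHyperbolic.BallModel (U21 x₀ blockK)

variable {F : HodgeCM.CMField} {ι₁ : F →+* ℂ} {V : HodgeCM.HermSpace3 F ι₁}

/-! ## §1 The holomorphic and the antiholomorphic cotangent forms are disjoint -/

/-- The imaginary unit as an element of `U(1)`. [folklore] -/
private theorem I_mem_unitary : Complex.I ∈ unitary ℂ := by
  rw [Unitary.mem_iff]
  constructor <;> simp [Complex.conj_I]

/-- The central circle element `k_I ↔ (1, i) ∈ U(2) × U(1)` of `Stab(x₀)` acts on the cotangent weight `τ₁ = weightOf x₀` by the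
scalar `i` (`τ₁ = 𝔭₋ : (A, d) ↦ d • Ā`, ★ `weightOf_cotangent_blockK`). [cite: BorelWallach2000, VI 4.8] -/
theorem weightOf_cotangent_blockK_one_I (c : Fin 2 → ℂ) :
    BallForms.isPullbackCocycle_cotangentCocycle.weightOf x₀ (blockK ((1 : Matrix.unitaryGroup (Fin 2) ℂ), ⟨Complex.I, I_mem_unitary⟩))
      c = Complex.I • c := by
  rw [BallForms.weightOf_cotangent_blockK, pMinus_apply]
  simp [matA, sclD]

/-- **The two Hodge types of degree one are disjoint: `holCotForms 𝔞 ⊓ conj (holCotForms 𝔞) = ⊥`** (for every archimedean factor `𝔞`).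
If `f = conj g` with `f, g ∈ holCotForms 𝔞`, the right `K_∞`-type condition at the central circle element `k_I` of `Stab(x₀)` gives
`f (x · ιinf k_I⁻¹) = i • f x` (type `τ₁`) and, conjugating the same identity for `g`, `f (x · ιinf k_I⁻¹) = −i • f x`; hence `f = 0`.
This is the `(1,0)` ∕ `(0,1)` splitting of [BorelWallach2000, VII 2.10] on the cotangent `K_∞`-type `τ₁ = 𝔭₋` of [ibid., VI 4.8].
[cite: BorelWallach2000, VII 2.10] [cite: BorelWallach2000, VI 4.8] -/
theorem disjoint_holCotForms_map_conjFun (𝔞 : ArchFactor F V) :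
    Disjoint (holCotForms 𝔞) ((holCotForms 𝔞).map (conjFun F V)) := by
  rw [Submodule.disjoint_def]
  intro f hfA hfB
  obtain ⟨g, hgA, rfl⟩ := Submodule.mem_map.mp hfB
  -- the `K_∞`-type clauses of `g` and of `conj g`
  obtain ⟨⟨⟨hWg, -⟩, -⟩, -⟩ := hgA
  obtain ⟨⟨⟨hWf, -⟩, -⟩, -⟩ := hfA
  -- the central circle element `k_I` of the stabiliser
  set kI : stabilizer (↥U21) x₀ := blockK ((1 : Matrix.unitaryGroup (Fin 2) ℂ), ⟨Complex.I, I_mem_unitary⟩) with hkI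
  have hτ : ∀ c : Fin 2 → ℂ, BallForms.isPullbackCocycle_cotangentCocycle.weightOf x₀ kI c = Complex.I • c :=
    weightOf_cotangent_blockK_one_I
  funext x
  -- type `τ₁` for `g`: `g (x · κ kI⁻¹) = i • g x`
  have hg : g (x * (𝔞.ιinf.comp (stabilizer (↥U21) x₀).subtype) kI⁻¹) = Complex.I • g x := by
    rw [hWg.2 kI⁻¹ x, inv_inv, hτ]
  -- type `τ₁` for `conj g`: `star (g (x · κ kI⁻¹)) = i • star (g x)`
  have hf : star (g (x * (𝔞.ιinf.comp (stabilizer (↥U21) x₀).subtype) kI⁻¹)) = Complex.I • star (g x) := by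
    have h := hWf.2 kI⁻¹ x
    rw [inv_inv, hτ] at h
    exact h
  -- compare: `(-i) • star (g x) = i • star (g x)`
  rw [hg, star_smul, Complex.star_def, Complex.conj_I] at hf
  have h2 : ((2 : ℂ) * Complex.I) • star (g x) = 0 := by
    rw [mul_smul, two_smul]
    nth_rewrite 1 [← hf]
    rw [neg_smul, neg_add_cancel]
  have hI2 : (2 : ℂ) * Complex.I ≠ 0 := mul_ne_zero two_ne_zero Complex.I_ne_zero
  have hz : star (g x) = 0 := (smul_eq_zero.mp h2).resolve_left hI2
  show star (g x) = (0 : (adelicDatum F V).Adelic → (Fin 2 → ℂ)) x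
  rw [hz]
  rfl

/-- Element form: a holomorphic cotangent form whose conjugate is again holomorphic is zero. [cite: BorelWallach2000, VII 2.10] -/
theorem eq_zero_of_mem_holCotForms_of_conjFun_mem {𝔞 : ArchFactor F V} {f : (adelicDatum F V).Adelic → (Fin 2 → ℂ)}
    (hf : f ∈ holCotForms 𝔞) (hcf : conjFun F V f ∈ holCotForms 𝔞) : f = 0 := by
  have hfB : f ∈ (holCotForms 𝔞).map (conjFun F V) :=
    Submodule.mem_map.mpr ⟨conjFun F V f, hcf, conjFun_conjFun F V f⟩
  exact (Submodule.disjoint_def.mp (disjoint_holCotForms_map_conjFun 𝔞)) f hf hfB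

/-! ## §2 Both Hodge types are stable under the finite-adelic right translation (honest `𝔞`) -/

/-- **`R_g` preserves `conj (holCotForms 𝔞)`** for an honest archimedean factor (`R_g` commutes with `conj`, ★ `conjFun_rightRep`, and
preserves `holCotForms 𝔞`, ★ `IsHonest.rightRep_mem_holCotForms`). [cite: BorelJacquet1979, §4.2] [cite: BorelWallach2000, VII 2.10] -/
theorem ArchFactor.IsHonest.rightRep_mem_map_conjFun_holCotForms {𝔞 : ArchFactor F V} (h𝔞 : 𝔞.IsHonest)
    {f : (adelicDatum F V).Adelic → (Fin 2 → ℂ)} (hf : f ∈ (holCotForms 𝔞).map (conjFun F V))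
    (g : ↥(HodgeCM.HermSpace3.adelicFin V)) :
    rightRep F V g f ∈ (holCotForms 𝔞).map (conjFun F V) := by
  obtain ⟨f', hf', rfl⟩ := Submodule.mem_map.mp hf
  exact Submodule.mem_map.mpr ⟨rightRep F V g f', h𝔞.rightRep_mem_holCotForms hf' g, conjFun_rightRep F V g f'⟩

/-- Submodule form: `holCotForms 𝔞 ≤ R_g⁻¹ (holCotForms 𝔞)` for an honest `𝔞`. [cite: BorelJacquet1979, §4.2] -/
theorem ArchFactor.IsHonest.holCotForms_le_comap_rightRep {𝔞 : ArchFactor F V} (h𝔞 : 𝔞.IsHonest)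
    (g : ↥(HodgeCM.HermSpace3.adelicFin V)) :
    holCotForms 𝔞 ≤ (holCotForms 𝔞).comap (rightRep F V g) :=
  fun _ hf => h𝔞.rightRep_mem_holCotForms hf g

/-- Submodule form: `conj (holCotForms 𝔞) ≤ R_g⁻¹ (conj (holCotForms 𝔞))` for an honest `𝔞`. [cite: BorelJacquet1979, §4.2] -/
theorem ArchFactor.IsHonest.map_conjFun_holCotForms_le_comap_rightRep {𝔞 : ArchFactor F V} (h𝔞 : 𝔞.IsHonest)
    (g : ↥(HodgeCM.HermSpace3.adelicFin V)) :
    (holCotForms 𝔞).map (conjFun F V) ≤ ((holCotForms 𝔞).map (conjFun F V)).comap (rightRep F V g) :=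
  fun _ hf => h𝔞.rightRep_mem_map_conjFun_holCotForms hf g

/-! ## §3 The stub shape: disjoint AND separately stable -/

/-- **S2 «Hodge types disjoint and stable»** for an honest archimedean factor `𝔞` (e.g. the factor of record `archFactorOf F V`,
★ `P4StubT1ArchFactor.archFactorOf_isHonest`): with `A := holCotForms 𝔞` and `B := A.map conjFun`, `Disjoint A B`, and `A`, `B` are each
stable under every `R_g`, `g ∈ U(V)(𝔸_{F⁺,f})` — so `cohForms 𝔞 = A ⊔ B` is the direct sum of two `G_f`-submodules (the `(1,0)`- and the
`(0,1)`-part). [cite: BorelWallach2000, VII 2.10] [cite: BorelJacquet1979, §4.2] -/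
theorem ArchFactor.IsHonest.hodgeTypes_disjoint_stable {𝔞 : ArchFactor F V} (h𝔞 : 𝔞.IsHonest) :
    Disjoint (holCotForms 𝔞) ((holCotForms 𝔞).map (conjFun F V)) ∧
      (∀ (g : ↥(HodgeCM.HermSpace3.adelicFin V)) (f : (adelicDatum F V).Adelic → (Fin 2 → ℂ)),
          f ∈ holCotForms 𝔞 → rightRep F V g f ∈ holCotForms 𝔞) ∧
      ∀ (g : ↥(HodgeCM.HermSpace3.adelicFin V)) (f : (adelicDatum F V).Adelic → (Fin 2 → ℂ)),
          f ∈ (holCotForms 𝔞).map (conjFun F V) → rightRep F V g f ∈ (holCotForms 𝔞).map (conjFun F V) :=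
  ⟨disjoint_holCotForms_map_conjFun 𝔞, fun g _ hf => h𝔞.rightRep_mem_holCotForms hf g,
    fun g _ hf => h𝔞.rightRep_mem_map_conjFun_holCotForms hf g⟩

/-- **`cohForms 𝔞` is the INTERNAL DIRECT SUM of its two Hodge types**: every cohomological cotangent form is UNIQUELY `a + conj a'` with
`a, a' ∈ holCotForms 𝔞` (existence is the definition `cohForms = A ⊔ A.map conj`; uniqueness is §1). [cite: BorelWallach2000, VII 2.10] -/
theorem isCompl_holCotForms_map_conjFun (𝔞 : ArchFactor F V) :
    IsCompl ((holCotForms 𝔞).comap (cohForms 𝔞).subtype) (((holCotForms 𝔞).map (conjFun F V)).comap (cohForms 𝔞).subtype) := by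
  refine ⟨?_, ?_⟩
  · rw [Submodule.disjoint_def]
    intro f hfA hfB
    have h := (Submodule.disjoint_def.mp (disjoint_holCotForms_map_conjFun 𝔞)) (f : _ → _) hfA hfB
    exact Subtype.ext h
  · rw [codisjoint_iff, eq_top_iff]
    rintro ⟨f, hf⟩ -
    obtain ⟨a, ha, b, hb, hab⟩ := Submodule.mem_sup.mp hf
    have ha' : a ∈ cohForms 𝔞 := holCotForms_le_cohForms 𝔞 ha
    have hb' : b ∈ cohForms 𝔞 := Submodule.mem_sup_right hb
    have : (⟨f, hf⟩ : cohForms 𝔞) = ⟨a, ha'⟩ + ⟨b, hb'⟩ := Subtype.ext hab.symm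
    rw [this]
    exact Submodule.add_mem_sup (Submodule.mem_comap.mpr ha) (Submodule.mem_comap.mpr hb)

end Summit.HodgeConjecture.HodgeConjecture.Cruxes.H413.CohFormsCarriers

end
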